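import Summits.Langlands.Langlands.Theses.SexticResolventInduction

/-!
# Crux `ResolventInduction` (stmt-Langlands-17259) — birth skeleton (BC3), line `birth`

Route: route-Langlands-SexticResolventInduction (K1 = `ResolventInduction`: weak automorphic
induction of the quadratic character η of E₁₂/E₆ along the sextic resolvent E₆/ℚ of an even
icosahedral ρ, landing on a CUSPIDAL (3,3) pair σ, σ′ on GL₃(𝔸_ℚ) with joint a.e. Satake multiset
{u,1,u⁻¹} ⊔ {u²,1,u⁻²}).

Skeleton (the route header's TWO-LAYER PLAN for K1, now importing the route file and concluding
the route decl BY NAME):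

* `stub_weakResolventInduction` — SHAPE-FREE weak induction: the Hecke L-function ζ_E₁₂/ζ_E₆ is
  (a.e.) the standard L-function of an isobaric sum of exactly two cuspidal constituents, i.e. the
  joint Satake multiset is realised by a cuspidal pair of shape (3,3) ∨ (1,5) ∨ (2,4) — raw weak
  automorphic induction of η to GL₆ plus Rankin–Selberg positivity Σ mᵢ² = ⟨3⊕3′,3⊕3′⟩ = 2
  (JacquetShalikaAJM1981II; ArthurClozelAMS120 Ch. 3 Prop. 7.2). This is the load-bearing, open stub
  (non-normal sextic layer with A₅ closure; CogdellPiatetskishapiro1994 converse attack, Maass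
  twists open).
* `stub_noCharacterConstituent` — pole exclusion of the (1,5) shape: a GL₁ ⊞ GL₅ realisation makes
  χ a finite-order Hecke character with χ(Frob_p) ∈ Satake multiset; at the density-1/60 totally
  split primes the multiset is {1,…,1}, and Rankin–Selberg/orthogonality forces χ = 1, whence
  ζ(s)·L(s,τ) = ζ_E₁₂(s)/ζ_E₆(s) would have a pole at s = 1 — but ζ_E₁₂/ζ_E₆ = L(s, η) is an ENTIRE
  Hecke L-function of E₆ (η ≠ 1). Provable modulo the tree's Jacquet–Shalika named facts (M).
* `stub_noRankTwoConstituent` — exclusion of the (2,4) chimera: no cuspidal κ on GL₂ can carry, at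
  almost every p, a sub-multiset of size 2 of {u,1,u⁻¹} ⊔ {u²,1,u⁻²} compatibly with the
  Rankin–Selberg identities for κ × κ̃, Sym² κ (GelbartJacquet1978) and κ × τ̃ against the A₅
  Chebotarev densities (1, 15, 20, 12, 12)/60 (L). 
* `ResolventInduction_of` — the kernel-checked composition A → B → C → K1 (case split on the shape;
  the (3,3) disjunct is the crux's conclusion verbatim).

Disproof used: none relevant (no `Disproof.lean` / `_false_without_` theorem is filed on this crux
as of 2026-08-17; `ledger crux ls stmt-Langlands-17259` lists only this line).
-/

namespace Summit.Langlands.Langlands.Cruxes.ResolventInduction.Birth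

open scoped BigOperators Topology Manifold Classical MeasureTheory ProbabilityTheory Matrix InnerProductSpace ComplexConjugate ContinuousMap
open Filter Set Function TopologicalSpace MeasureTheory

/-- stub A (load-bearing; weak automorphic induction of η along the sextic resolvent E₆/ℚ, with
Rankin–Selberg positivity Σ mᵢ² = 2 built in): for every irreducible even icosahedral ρ the joint
a.e. Satake multiset {u,1,u⁻¹} ⊔ {u²,1,u⁻²} of (Ad ρ ⊕ Ad ρ′)(Frob_p) is carried by a PAIR of
cuspidal automorphic representations of shape (3,3), (1,5) or (2,4). -/
theorem stub_weakResolventInduction : ∀ ρ : Literature.NumberTheory.GaloisRepresentations.FramedGaloisRep ℚ ℂ 2, ρ.toGaloisRep.IsIrreducible → Nonempty ((Matrix.ProjGenLinGroup.mk.comp ρ.toMonoidHom).range ≃* alternatingGroup (Fin 5)) → (∀ (φ : ℚ →+* ℝ) (c : Field.absoluteGaloisGroup ℚ), Literature.NumberTheory.GaloisRepresentations.IsComplexConjugation φ c → Matrix.GeneralLinearGroup.det (ρ c) = 1) → (∃ (hcpt3 : Literature.NumberTheory.Automorphic.isCompact_glFiniteIntegralLevel 3 ℚ) (σ σ' : Literature.NumberTheory.Automorphic.CuspidalAutomorphicRepData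 3 ℚ hcpt3), ∀ᶠ v : IsDedekindDomain.HeightOneSpectrum (NumberField.RingOfIntegers ℚ) in Filter.cofinite, ∃ (α β : Multiset ℂ) (l m : ℂ), σ.1.HasSatakeParamAt v α ∧ σ'.1.HasSatakeParamAt v β ∧ ρ.IsUnramifiedAt v ∧ ρ.HasFrobCharpolyAt v (Literature.NumberTheory.Automorphic.satakePolynomial {l, m}) ∧ α + β = {l / m, 1, m / l} + (if l + m = 0 then {-1, 1, -1} else {(l / m) ^ 2, 1, (m / l) ^ 2})) ∨ (∃ (hcpt1 : Literature.NumberTheory.Automorphic.isCompact_glFiniteIntegralLevel 1 ℚ) (hcpt5 : Literature.NumberTheory.Automorphic.isCompact_glFiniteIntegralLevel 5 ℚ) (χ : Literature.NumberTheory.Automorphic.CuspidalAutomorphicRepData 1 ℚ hcpt1) (τ : Literature.NumberTheory.Automorphic.CuspidalAutomorphicRepData 5 ℚ hcpt5), ∀ᶠ v : IsDedekindDomain.HeightOneSpectrum (NumberField.RingOfIntegers ℚ) in Filter.cofinite, ∃ (α β : Multiset ℂ) (l m : ℂ), χ.1.HasSatakeParamAt v α ∧ τ.1.HasSatakeParamAt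 v β ∧ ρ.IsUnramifiedAt v ∧ ρ.HasFrobCharpolyAt v (Literature.NumberTheory.Automorphic.satakePolynomial {l, m}) ∧ α + β = {l / m, 1, m / l} + (if l + m = 0 then {-1, 1, -1} else {(l / m) ^ 2, 1, (m / l) ^ 2})) ∨ (∃ (hcpt2 : Literature.NumberTheory.Automorphic.isCompact_glFiniteIntegralLevel 2 ℚ) (hcpt4 : Literature.NumberTheory.Automorphic.isCompact_glFiniteIntegralLevel 4 ℚ) (κ : Literature.NumberTheory.Automorphic.CuspidalAutomorphicRepData 2 ℚ hcpt2) (τ : Literature.NumberTheory.Automorphic.CuspidalAutomorphicRepData 4 ℚ hcpt4), ∀ᶠ v : IsDedekindDomain.HeightOneSpectrum (NumberField.RingOfIntegers ℚ) in Filter.cofinite, ∃ (α β : Multiset ℂ) (l m : ℂ), κ.1.HasSatakeParamAt v α ∧ τ.1.HasSatakeParamAt v β ∧ ρ.IsUnramifiedAt v ∧ ρ.HasFrobCharpolyAt v (Literature.NumberTheory.Automorphic.satakePolynomial {l, m}) ∧ α + β = {l / m, 1, m / l} + (if l + m = 0 then {-1, 1, -1} else {(l / m) ^ 2, 1, (m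 / l) ^ 2})) := by
  sorry

/-- stub B (pole exclusion, size M): the (1,5) shape is impossible — the GL₁ constituent χ is forced
to be trivial by the totally split primes, and then ζ(s) · L(s,τ) = ζ_E₁₂(s)/ζ_E₆(s) = L(s, η ∘ N)
would have a pole at s = 1, contradicting that the Hecke L-function of the non-trivial quadratic
character η of E₆ is entire (Jacquet–Shalika non-vanishing/pole bookkeeping on the automorphic
side). -/
theorem stub_noCharacterConstituent : ∀ ρ : Literature.NumberTheory.GaloisRepresentations.FramedGaloisRep ℚ ℂ 2, ρ.toGaloisRep.IsIrreducible → Nonempty ((Matrix.ProjGenLinGroup.mk.comp ρ.toMonoidHom).range ≃* alternatingGroup (Fin 5)) → (∀ (φ : ℚ →+* ℝ) (c : Field.absoluteGaloisGroup ℚ), Literature.NumberTheory.GaloisRepresentations.IsComplexConjugation φ c → Matrix.GeneralLinearGroup.det (ρ c) = 1) → ¬ (∃ (hcpt1 : Literature.NumberTheory.Automorphic.isCompact_glFiniteIntegralLevel 1 ℚ) (hcpt5 : Literature.NumberTheory.Automorphic.isCompact_glFiniteIntegralLevel 5 ℚ) (χ : Literature.NumberTheory.Automorphic.CuspidalAutomorphicRepData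 1 ℚ hcpt1) (τ : Literature.NumberTheory.Automorphic.CuspidalAutomorphicRepData 5 ℚ hcpt5), ∀ᶠ v : IsDedekindDomain.HeightOneSpectrum (NumberField.RingOfIntegers ℚ) in Filter.cofinite, ∃ (α β : Multiset ℂ) (l m : ℂ), χ.1.HasSatakeParamAt v α ∧ τ.1.HasSatakeParamAt v β ∧ ρ.IsUnramifiedAt v ∧ ρ.HasFrobCharpolyAt v (Literature.NumberTheory.Automorphic.satakePolynomial {l, m}) ∧ α + β = {l / m, 1, m / l} + (if l + m = 0 then {-1, 1, -1} else {(l / m) ^ 2, 1, (m / l) ^ 2})) := by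
  sorry

/-- stub C (rank-two chimera exclusion, size L): the (2,4) shape is impossible — a cuspidal κ on
GL₂(𝔸_ℚ) whose Satake pair at a.e. p is a sub-multiset of {u,1,u⁻¹} ⊔ {u²,1,u⁻²} violates the
Rankin–Selberg pole counts for κ × κ̃ / Sym² κ (Gelbart–Jacquet) / κ × τ̃ weighted by the A₅
Chebotarev densities (1,15,20,12,12)/60. -/
theorem stub_noRankTwoConstituent : ∀ ρ : Literature.NumberTheory.GaloisRepresentations.FramedGaloisRep ℚ ℂ 2, ρ.toGaloisRep.IsIrreducible → Nonempty ((Matrix.ProjGenLinGroup.mk.comp ρ.toMonoidHom).range ≃* alternatingGroup (Fin 5)) → (∀ (φ : ℚ →+* ℝ) (c : Field.absoluteGaloisGroup ℚ), Literature.NumberTheory.GaloisRepresentations.IsComplexConjugation φ c → Matrix.GeneralLinearGroup.det (ρ c) = 1) → ¬ (∃ (hcpt2 : Literature.NumberTheory.Automorphic.isCompact_glFiniteIntegralLevel 2 ℚ) (hcpt4 : Literature.NumberTheory.Automorphic.isCompact_glFiniteIntegralLevel 4 ℚ) (κ : Literature.NumberTheory.Automorphic.CuspidalAutomorphicRepData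 2 ℚ hcpt2) (τ : Literature.NumberTheory.Automorphic.CuspidalAutomorphicRepData 4 ℚ hcpt4), ∀ᶠ v : IsDedekindDomain.HeightOneSpectrum (NumberField.RingOfIntegers ℚ) in Filter.cofinite, ∃ (α β : Multiset ℂ) (l m : ℂ), κ.1.HasSatakeParamAt v α ∧ τ.1.HasSatakeParamAt v β ∧ ρ.IsUnramifiedAt v ∧ ρ.HasFrobCharpolyAt v (Literature.NumberTheory.Automorphic.satakePolynomial {l, m}) ∧ α + β = {l / m, 1, m / l} + (if l + m = 0 then {-1, 1, -1} else {(l / m) ^ 2, 1, (m / l) ^ 2})) := by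
  sorry

/-! ## The stub statements as named propositions (the composition's hypotheses, BY NAME)

Tree convention for registered skeletons (`#h21_check_skeleton` admits a hypothesis only if its head
constant is a registered obligation or carries a declared stub's short name): each `_Goal.stub_X` is
LITERALLY the type of the sorried theorem `stub_X` (`type_of%`), so the composition below takes the
three stub statements by name and nothing else. -/

namespace _Goal

/-- The statement of `stub_weakResolventInduction`, as a named `Prop` (literally its type). -/
def stub_weakResolventInduction : Prop :=
  type_of% @Summit.Langlands.Langlands.Cruxes.ResolventInduction.Birth.stub_weakResolventInduction

/-- The statement of `stub_noCharacterConstituent`, as a named `Prop` (literally its type). -/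
def stub_noCharacterConstituent : Prop :=
  type_of% @Summit.Langlands.Langlands.Cruxes.ResolventInduction.Birth.stub_noCharacterConstituent

/-- The statement of `stub_noRankTwoConstituent`, as a named `Prop` (literally its type). -/
def stub_noRankTwoConstituent : Prop :=
  type_of% @Summit.Langlands.Langlands.Cruxes.ResolventInduction.Birth.stub_noRankTwoConstituent

end _Goal

/-! ## The composition (kernel-checked, no `sorry`; concludes the route decl BY NAME) -/

/-- **`A → B → C → ResolventInduction`.** Shape-free weak induction (A) + exclusion of the (1,5)
shape (B) and of the (2,4) shape (C) ⇒ the (3,3) cuspidal pair, i.e. the route crux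
`Summit.Langlands.Langlands.Theses.SexticResolventInduction.ResolventInduction` by name: fix an even
icosahedral ρ, case on the shape delivered by A; the (3,3) disjunct is the crux's conclusion
verbatim, the other two are refuted by B and C. -/
theorem ResolventInduction_of (hA : _Goal.stub_weakResolventInduction)
    (hB : _Goal.stub_noCharacterConstituent) (hC : _Goal.stub_noRankTwoConstituent) :
    Summit.Langlands.Langlands.Theses.SexticResolventInduction.ResolventInduction := by
  unfold _Goal.stub_weakResolventInduction at hA
  unfold _Goal.stub_noCharacterConstituent at hB
  unfold _Goal.stub_noRankTwoConstituent at hC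
  intro ρ h1 h2 h3
  rcases hA ρ h1 h2 h3 with h33 | h15 | h24
  · exact h33
  · exact absurd h15 (hB ρ h1 h2 h3)
  · exact absurd h24 (hC ρ h1 h2 h3)

/-- By-name sanity check (an `example`, not a declaration of the file): the open stubs feed the
composition as they stand (it inherits their `sorry`s and is NOT a proof of the crux). -/
example : Summit.Langlands.Langlands.Theses.SexticResolventInduction.ResolventInduction :=
  ResolventInduction_of stub_weakResolventInduction stub_noCharacterConstituent stub_noRankTwoConstituent

end Summit.Langlands.Langlands.Cruxes.ResolventInduction.Birth
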